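import Summits.HodgeConjecture.HodgeConjecture.Theorems.R90S2ArchKitHRowsDefs   -- ★ brick 2 (p862362): `HInfExt.ofCptRows`, `nonempty_pktInfH_ofCptRows`, `ofCptRows_lawKH5∕KT3`; ⊇ ★ HDefs (`HInfExt`, `CptPlace`, `PktInfH`, `tShift`), ⊇ ★ `F0P3XiArchDataOfRecord` (`archTypeOfRecord`)
import Literature.NumberTheory.Rogawski1990.XiArchPinned                          -- ★ `ArchSignRecipe.tOfArchType`, `XiArchPinned`
import HarnessLib

/-!
# K2_E1b ∕ R90-TF S2 — HOLE D-S2-6 «THE 𝟙-COMPATIBLE ONE-DIMENSIONAL `H_w`-ROWS OF RECORD AT A COMPACT PLACE»: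
# `onesCompatRow L ι μω w`, `HInfExt.IsRowsOfRecord`, the instance of record `HInfExt.xiRows L ι μω`

Cell `hodgecm-mathlib`, Track B «K2-LIT» ∕ programme R90-TF, section S2 «Ch11-arch» (dealer K2E1b-plan (g7)), E1b estate hand «E1b-D-S2-6» dealt BY NAME
2026-09-04T22:04:47Z to K2E1-p12 (g4); crux H413 = `stmt-HodgeConjecture-24833` (`--supports` helper, definition lane; closes nothing by itself).
RULING S2-R15 (2026-09-04T21:57:56Z) «Q-S1 CONSEQUENCE FOR THE `H_∞`-BLOCK: `xiOnly` IS EMPTY ON PATH; ED. 3 GOES PARAMETRIC; D-S2-6 PROMOTED TO ON-PATH»: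
on the h413 path (`3 ≤ [L⁺ : ℚ]`, R-QS1-7) there are ≥ 2 real places of `L⁺` where `G′_w = U(3)` is COMPACT, and the archimedean `H`-kit of record
(★ `rogawskiArchKitH L ι H μω X`, `Theorems/R90S2ArchKitHDefs.lean`) has an `H_∞`-packet only if the extension datum `X` LICENSES a one-dimensional
`H_w`-datum at every such `w` (★ `PktInfH L ι X = HLabIota X × {κ ∕∕ ∀ w, κ w ∈ X.cptLab w}`; ★ S2-R15 FACT `isEmpty_pktInfH_xiOnly`).  WHICH rows are
licensed is print's Prop. 14.4.2 (c) [Rogawski1990 p. 236]: at a place `w` where `G′_w` is compact, a one-dimensional `ξ_w = ξ(a,c,b)` (`m = 1`) or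
`ξ(b,a,c)` (`n = 1`) of `H_w = U(1,1) × U(1)` satisfies `Tr ξ_w(f′^H) = −Tr F_φ(f′)` (`mn ≠ 0`), and with the `G′`-side of record seeing only
`F_φ = 𝟙_{U(3)_w}` (`φ = φ(1, 0, −1)`, V31) EXACTLY TWO rows pair non-trivially: «`ξ(1,−1,0)`» and «`ξ(0,1,−1)`» — in the tree's currency, the
characters `ξ_w` whose exponents lie on the DEGREE-ONE COHOMOLOGICAL LOCUS ★ `ArchSignRecipe.IsCohTrivial p q t` (`rogTriple p q t = (1, 0, −1)`,
`Literature/NumberTheory/Rogawski1990/OneDimAutRepH.lean`; the `jInfOfRecord`∕`archDegOneClass` locus of ★ `K2E1bCarriersOfRecord`, Prop. 15.2.1 (b))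
for Rogawski's parameter `t` of `μω` AT `w` (★ `ArchSignRecipe.tOfArchType (archTypeOfRecord μω)`), each with sign `−1` relative to `Δ″_w`.

CURRENCY (census `K2/K2E1-p12/g4/CENSUS-HEADS-D-S2-6.md`): ★ `HInfExt.cptLab w : Finset (ℤ × ℤ)` is in PLACE-indexed exponent currency `(eη_w, eψ_w)`
(★ HDefs §1; consumed by ★ `archTrHOfRecord_xiTok` through `expVec_cpt`; the pin ★ `archTrHOfRecord_xiTok_ofRecord` takes a global `ξ`'s compact vector to be
`fun w => (ξ.eη w.1, ξ.eψ w.1)`).  In that currency the locus at `w` is the LITERALLY EMBEDDING-FREE two-element set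
`{((k₀ w + 3)∕2, −1), ((k₀ w − 3)∕2, 1)}`, `k₀ = archTypeOfRecord μω` (odd, ★ `odd_archTypeOfRecord`) — equivalently `{(t_w + 2, −1), (t_w − 1, 1)}` with
`t_w = tOfArchType k₀ σ_w` at Mathlib's embedding `σ_w` of `w` — and the EMBEDDING READING is a THEOREM: for EVERY complex embedding `σ` over `w`,
`(e₁ w, e₂ w) ∈ row ↔ IsCohTrivial (expAt e₁ σ) (expAt e₂ σ) (tOfArchType k₀ σ)` (`mem_rowOfArchType_iff_isCohTrivial`; the conjugate embedding replaces
`(p, q, t)` by `(−p, −q, −t − 1)`, ★ `expAt_conjugate` ∕ `tOfArchType_conjugate`, and the locus is invariant, ★ `isCohTrivial_conj` — the `J⁺∕J⁻` LABELS of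
the two rows swap under `σ ↦ σ̄` (★ `rogSign_conj`), the SET does not; rows are named here by `e₂ = ∓1`, never by `J^±`).

PRINT DICTIONARY (dealer's (α), S2-R15 (3)): a row `κ = (eη_w, eψ_w)` ↔ one of the TWO characters `ξ_w` of `H_w = U(1,1)_w × U(1)_w` of cohomologically-trivial
(trivial-coefficient, `𝟙_{U(3)_w}`-compatible) type at `w` [Rogawski1990 Prop. 14.4.2 (c) p. 236; Prop. 12.3.2 p. 177]; the sign `−1` on both rows (§3–§4) is the
κ-PAIRING OF RECORD — S2's reading of p. 236 (`mn ≠ 0` case), carried here as DATA with this honest label and to be AUDITED against print when σ14 (KT3) is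
typed over `xiRows` (R90-C11-audit1 PRE-BOX 2026-09-04T22:13:22Z R2: a wrong sign would surface there as a refutable socket).
JUNK GUARD (audit1 R1): `rowOfArchType k w` uses `ℤ` floor division and is MEANINGFUL ONLY FOR ODD `k w` (at an even `k w` it is a junk pair); every read-back of
§2 is `Odd`-guarded, and `onesCompatRow μω` is of record only at the letters' frames (`hμu : μω.IsUnitary`, `hμω : μω|_{𝕀_{L⁺}} = ω_{L∕L⁺}` ⇒ ★
`odd_archTypeOfRecord`) — every SOCKET typed over `HInfExt.xiRows L ι μω` must carry `hμu` + `hμω`, else it quantifies over junk rows too.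

CONTENTS (0 `sorry`; 5 definitions (`rowOfArchType`, `onesCompatRow`, `HInfExt.IsRowsOfRecord`, `HInfExt.xiRows`, `pktInfHOfPinned`) + read-backs; no instance,
no notation, no law content):
* §1 `rowOfArchType L ι k w` (generic archimedean type `k`, pure arithmetic) and `onesCompatRow L ι μω w := rowOfArchType L ι (archTypeOfRecord μω) w`
  (every-witness-safe: any unitary type `k` of `μω` IS `k₀`, ★ `archTypeOfRecord_eq`); membership, `card = 2` (unconditional), non-emptiness.
* §2 the embedding reading (= spec (ii) PROVED): `mem_rowOfArchType_iff_isCohTrivial`, the global-`ξ` forms `eExponents_mem_rowOfArchType_iff`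
  (`(ξ.eη w, ξ.eψ w) ∈ row ↔ ξ.IsCohTrivialAt (tOfArchType k σ) σ`) and `eExponents_mem_rowOfArchType_of_xiArchPinned` (every compact component of a
  PINNED global `ξ` — ★ `XiArchPinned L ξ μω k`, F0P2's S2♯ currency — is licensed), the `t_w`-spelling `rowOfArchType_eq_pair_tOfArchType`.
* §3 `HInfExt.IsRowsOfRecord L ι μω X` (spec (iii): `cptLab = onesCompatRow` and sign `−1` on it) with `Iff.rfl` unfolding and read-backs; the `d = 1`
  print shell ★ `xiOnly` is NOT of record as soon as there is a compact place.
* §4 the INSTANCE OF RECORD `HInfExt.xiRows L ι μω := ofCptRows (onesCompatRow L ι μω) (sign −1 on the rows, junk 0 off them)` (spec (iv), over ★ brick 2),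
  `xiRows_isRowsOfRecord`, `nonempty_pktInfH_xiRows` (the positive twin of ★ S2-R15 FACT: ON PATH THE KIT OF RECORD HAS `H_∞`-PACKETS), the vacuous
  extension law-shares re-exported (`xiRows_lawKH5`, `xiRows_lawKT3` — NOT the (KH5)∕(KT3) content on `xi`-labels, which is the export's debt), and
  `exponents_licensed_xiRows_of_xiArchPinned` (S7's `ρXi ξ : PktInfH (xiRows)` is constructible for a pinned `ξ`).

HONEST LABEL: HC_CM is proved only modulo the 7 printed citations (2 remaining named inputs: hLiu418 = `stmt-HodgeConjecture-24832`, h413 =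
`stmt-HodgeConjecture-24833`) until rung 0 closes; this file names what the licensed `H_∞`-rows ARE on path and proves their bookkeeping — it pays no
socket (σ14 (KT3) over `xiRows` is S2's debt, the square-integrable `H_∞`-labels remain hole G-H2); count-neutral.

References: [Rogawski1990] J. Rogawski, *Automorphic representations of unitary groups in three variables*, Ann. of Math. Stud. 123 (1990): §12.3
pp. 174–178 (the parameter `t`, `μ_ι(z) = (z∕z̄)^{t+1∕2}`; the `±` cases `ξ(b,a,c)` ∕ `ξ(a,c,b)`, Prop. 12.3.2 p. 177, Prop. 12.3.3 (a)); §14.4 Prop. 14.4.2 (c)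
p. 236; §14.6 p. 244; Prop. 15.2.1 (b) p. 249.  [Liu2021] Y. Liu, *Theta correspondence for almost unramified representations of unitary groups*,
J. Number Theory 230 (2022), Remark 4.2 (odd unitary archimedean type of `μω`).
-/

set_option autoImplicit false
-- the mandated namespace repeats the single-problem summit's segment (`HodgeConjecture.HodgeConjecture`)
set_option linter.dupNamespace false

noncomputable section

open NumberField
open scoped Classical

namespace Summit.HodgeConjecture.HodgeConjecture.R90.S2

open Literature.NumberTheory Literature.NumberTheory.Automorphic Literature.NumberTheory.Rogawski1990 Literature.NumberTheory.GaloisRepresentations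
open Summit.HodgeConjecture.HodgeConjecture.Cruxes.H413
open Summit.HodgeConjecture.HodgeConjecture.Cruxes.H413.F0P3XiArchDataOfRecord (archTypeOfRecord odd_archTypeOfRecord archTypeOfRecord_eq)

section Frame

variable (L : Type) [Field L] [NumberField L] [IsCMField L] (ι : L →+* ℂ)

/-! ## §1 The two `𝟙`-compatible one-dimensional rows at a compact place [§14.4 Prop. 14.4.2 (c) p. 236; §12.3 p. 178; Prop. 15.2.1 (b) p. 249] -/

/-- **`rowOfArchType L ι k w`** — for an archimedean type `k : InfinitePlace L → ℤ` (of `μω`: `μω_w(z) = (z∕|z|)^{k w}`, Rogawski's `2t + 1 = −expAt k σ`) and a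
compact place `w ≠ w(ι)`: the two one-dimensional `H_w`-rows `ξ_w` whose exponents lie on the degree-one cohomological locus `φ(a,b,c) = φ(1,0,−1)` for the
parameter `t` of `k` at `w`, in PLACE-indexed exponent currency `(e₁, e₂) = (eη_w, eψ_w)`: `{((k w + 3)∕2, −1), ((k w − 3)∕2, 1)}` — the rows «`n = 1`»
(`e₂ = −1` read at `σ_w`) and «`m = 1`» of Prop. 14.4.2 (c).  Pure arithmetic in `k w`; meaningful for odd `k w`. [cite: Rogawski1990, §14.4 Prop. 14.4.2 p. 236; §12.3 p. 178] -/
def rowOfArchType (k : InfinitePlace L → ℤ) (w : CptPlace L ι) : Finset (ℤ × ℤ) :=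
  {((k w.1 + 3) / 2, -1), ((k w.1 - 3) / 2, 1)}

/-- **`onesCompatRow L ι μω w` — THE TWO `𝟙_{U(3)_w}`-COMPATIBLE CHARACTER ROWS OF RECORD at the compact place `w`** (hole D-S2-6, RULING S2-R15 (3)): the rows
of ★ `rowOfArchType` at the unitary archimedean type OF RECORD `k₀ = archTypeOfRecord μω` of Rogawski's `μ = μω` — the E1b degree-one locus
(`IsCohTrivial`, `jInfOfRecord`∕`archDegOneClass`) transported to `w`; embedding-free by construction (§2 reads it at every embedding over `w`).
[cite: Rogawski1990, §14.4 Prop. 14.4.2 p. 236; §12.3 p. 178; Prop. 15.2.1 p. 249] [cite: Liu2021, Remark 4.2] -/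
def onesCompatRow (μω : HeckeCharacter L) (w : CptPlace L ι) : Finset (ℤ × ℤ) :=
  rowOfArchType L ι (archTypeOfRecord μω) w

variable (k : InfinitePlace L → ℤ) (μω : HeckeCharacter L) (w : CptPlace L ι)

/-- Unfolding (`rfl`): the rows of record are the rows at `k₀ = archTypeOfRecord μω`. [cite: Rogawski1990, §14.4 Prop. 14.4.2 p. 236] -/
theorem onesCompatRow_def : onesCompatRow L ι μω w = rowOfArchType L ι (archTypeOfRecord μω) w := rfl

/-- **EVERY-WITNESS-SAFE**: for a unitary `μω`, the rows at ANY unitary archimedean type `(k, 0)` of `μω` are the rows of record (★ `archTypeOfRecord_eq`).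
[cite: Liu2021, Remark 4.2] [cite: Rogawski1990, §12.3 p. 174] -/
theorem onesCompatRow_eq_rowOfArchType {μω : HeckeCharacter L} (hμu : μω.IsUnitary) {k : InfinitePlace L → ℤ}
    (hk : μω.HasUnitaryArchType k (fun _ => 0)) (w : CptPlace L ι) : onesCompatRow L ι μω w = rowOfArchType L ι k w := by
  rw [onesCompatRow_def, archTypeOfRecord_eq hμu hk]

/-- Membership in the rows: `κ = ((k w + 3)∕2, −1)` or `κ = ((k w − 3)∕2, 1)`. [cite: Rogawski1990, §14.4 Prop. 14.4.2 p. 236] -/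
theorem mem_rowOfArchType_iff (κ : ℤ × ℤ) :
    κ ∈ rowOfArchType L ι k w ↔ κ = ((k w.1 + 3) / 2, -1) ∨ κ = ((k w.1 - 3) / 2, 1) := by
  rw [rowOfArchType, Finset.mem_insert, Finset.mem_singleton]

/-- Membership in the rows of record. [cite: Rogawski1990, §14.4 Prop. 14.4.2 p. 236] -/
theorem mem_onesCompatRow_iff (κ : ℤ × ℤ) :
    κ ∈ onesCompatRow L ι μω w ↔ κ = ((archTypeOfRecord μω w.1 + 3) / 2, -1) ∨ κ = ((archTypeOfRecord μω w.1 - 3) / 2, 1) :=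
  mem_rowOfArchType_iff L ι (archTypeOfRecord μω) w κ

/-- The «`n = 1`» row `((k w + 3)∕2, −1)` is licensed. [cite: Rogawski1990, §14.4 Prop. 14.4.2 p. 236; §12.3 p. 178] -/
theorem fst_mem_rowOfArchType : ((k w.1 + 3) / 2, -1) ∈ rowOfArchType L ι k w := by
  rw [mem_rowOfArchType_iff]; exact Or.inl rfl

/-- The «`m = 1`» row `((k w − 3)∕2, 1)` is licensed. [cite: Rogawski1990, §14.4 Prop. 14.4.2 p. 236; §12.3 p. 178] -/
theorem snd_mem_rowOfArchType : ((k w.1 - 3) / 2, 1) ∈ rowOfArchType L ι k w := by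
  rw [mem_rowOfArchType_iff]; exact Or.inr rfl

/-- The two rows are distinct (their `eψ_w`-exponents are `−1 ≠ 1`); pure arithmetic in the type `n = k w`. [cite: Rogawski1990, §14.4 Prop. 14.4.2 p. 236] -/
theorem rowPair_fst_ne_snd (n : ℤ) : ((n + 3) / 2, (-1 : ℤ)) ≠ ((n - 3) / 2, 1) := by
  intro h
  have h2 := congrArg Prod.snd h
  simp only at h2
  omega

/-- **EXACTLY TWO rows are licensed at each compact place** (unconditionally: the second coordinates differ). [cite: Rogawski1990, §14.4 Prop. 14.4.2 p. 236] -/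
theorem card_rowOfArchType : (rowOfArchType L ι k w).card = 2 :=
  Finset.card_pair (rowPair_fst_ne_snd (k w.1))

/-- **`card (onesCompatRow L ι μω w) = 2`** — the dealer's spec (i): the two `𝟙_{U(3)_w}`-compatible rows «`m = 1`» ∕ «`n = 1`».
[cite: Rogawski1990, §14.4 Prop. 14.4.2 p. 236; §12.3 Prop. 12.3.2 p. 177] -/
theorem card_onesCompatRow : (onesCompatRow L ι μω w).card = 2 :=
  card_rowOfArchType L ι (archTypeOfRecord μω) w

/-- The rows are non-empty. [cite: Rogawski1990, §14.4 Prop. 14.4.2 p. 236] -/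
theorem rowOfArchType_nonempty : (rowOfArchType L ι k w).Nonempty :=
  ⟨_, fst_mem_rowOfArchType L ι k w⟩

/-- The rows of record are non-empty at every compact place. [cite: Rogawski1990, §14.4 Prop. 14.4.2 p. 236] -/
theorem onesCompatRow_nonempty : (onesCompatRow L ι μω w).Nonempty :=
  rowOfArchType_nonempty L ι (archTypeOfRecord μω) w

/-- Every licensed row has `eψ_w`-exponent `±1`. [cite: Rogawski1990, §12.3 p. 178; Prop. 15.2.1 p. 249] -/
theorem snd_eq_of_mem_rowOfArchType {κ : ℤ × ℤ} (h : κ ∈ rowOfArchType L ι k w) : κ.2 = -1 ∨ κ.2 = 1 := by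
  rw [mem_rowOfArchType_iff] at h
  rcases h with h | h <;> simp [h]

/-! ## §2 The embedding reading: the rows ARE the degree-one cohomological locus at every embedding over `w` [§12.3 pp. 174–178; Prop. 15.2.1 (b) p. 249] -/

/-- **EMBEDDING-INDEPENDENCE, PROVED (spec (ii))**: for an odd type at `w` and ANY complex embedding `σ` of `L` over `w` (`σ = σ_w` or `σ̄_w`), a place-indexed
exponent pair `(e₁ w, e₂ w)` is one of the two rows iff its embedding reading `(p, q) = (expAt e₁ σ, expAt e₂ σ)` lies on the degree-one cohomological locus
`φ(a,b,c) = φ(1,0,−1)` for Rogawski's parameter `t = tOfArchType k σ` of `k` at `σ` (★ `isCohTrivial_iff`: `(q = 1 ∧ p + t = −2) ∨ (q = −1 ∧ p + t = 1)`; at `σ̄`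
the triple `(p, q, t)` becomes `(−p, −q, −t − 1)` and the locus is invariant). [cite: Rogawski1990, §12.3 pp. 174–178; Prop. 15.2.1 p. 249] -/
theorem mem_rowOfArchType_iff_isCohTrivial (hk : Odd (k w.1)) (σ : L →+* ℂ) (hσ : InfinitePlace.mk σ = w.1) (e₁ e₂ : InfinitePlace L → ℤ) :
    (e₁ w.1, e₂ w.1) ∈ rowOfArchType L ι k w ↔
      ArchSignRecipe.IsCohTrivial (OneDimAutRepH.expAt e₁ σ) (OneDimAutRepH.expAt e₂ σ) (ArchSignRecipe.tOfArchType k σ) := by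
  obtain ⟨m, hm⟩ := hk
  rw [mem_rowOfArchType_iff, ArchSignRecipe.isCohTrivial_iff, Prod.mk.injEq, Prod.mk.injEq, hm]
  unfold ArchSignRecipe.tOfArchType OneDimAutRepH.expAt
  by_cases hσe : σ = (InfinitePlace.mk σ).embedding
  · rw [if_pos hσe, if_pos hσe, if_pos hσe, hσ, hm]
    omega
  · rw [if_neg hσe, if_neg hσe, if_neg hσe, hσ, hm]
    omega

/-- The embedding reading of the rows of record (at the letters' frames `μω` is unitary with `μω|_{𝕀_{L⁺}} = ω_{L∕L⁺}`, so `k₀` is odd, ★ `odd_archTypeOfRecord`).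
[cite: Rogawski1990, §12.3 pp. 174–178; Prop. 15.2.1 p. 249] [cite: Liu2021, Remark 4.2] -/
theorem mem_onesCompatRow_iff_isCohTrivial (hμu : μω.IsUnitary)
    (hμω : ∀ x : GaloisRepresentations.ideleGroup ↥(maximalRealSubfield L),
      μω (AdeleRing.ideleBaseChange (↥(maximalRealSubfield L)) L x) = quadraticHeckeCharCM L x)
    (σ : L →+* ℂ) (hσ : InfinitePlace.mk σ = w.1) (e₁ e₂ : InfinitePlace L → ℤ) :
    (e₁ w.1, e₂ w.1) ∈ onesCompatRow L ι μω w ↔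
      ArchSignRecipe.IsCohTrivial (OneDimAutRepH.expAt e₁ σ) (OneDimAutRepH.expAt e₂ σ)
        (ArchSignRecipe.tOfArchType (archTypeOfRecord μω) σ) :=
  mem_rowOfArchType_iff_isCohTrivial L ι (archTypeOfRecord μω) w (odd_archTypeOfRecord μω hμu hμω w.1) σ hσ e₁ e₂

/-- **GLOBAL ONE-DIMENSIONAL `ξ`**: the compact component `(ξ.eη w, ξ.eψ w)` of `ξ` is one of the two rows iff `ξ_σ` is of cohomological type for trivial coefficients
w.r.t. `t = tOfArchType k σ` (★ `OneDimAutRepH.IsCohTrivialAt`; `pη ξ σ = expAt ξ.eη σ`, `qψ ξ σ = expAt ξ.eψ σ`), at any `σ` over `w`.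
[cite: Rogawski1990, Prop. 15.2.1 p. 249; §12.3 p. 178] -/
theorem eExponents_mem_rowOfArchType_iff (hk : Odd (k w.1)) (ξ : OneDimAutRepH L) (σ : L →+* ℂ) (hσ : InfinitePlace.mk σ = w.1) :
    (ξ.eη w.1, ξ.eψ w.1) ∈ rowOfArchType L ι k w ↔ ξ.IsCohTrivialAt (ArchSignRecipe.tOfArchType k σ) σ :=
  mem_rowOfArchType_iff_isCohTrivial L ι k w hk σ hσ ξ.eη ξ.eψ

/-- The same at the type of record. [cite: Rogawski1990, Prop. 15.2.1 p. 249; §12.3 p. 178] [cite: Liu2021, Remark 4.2] -/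
theorem eExponents_mem_onesCompatRow_iff (hμu : μω.IsUnitary)
    (hμω : ∀ x : GaloisRepresentations.ideleGroup ↥(maximalRealSubfield L),
      μω (AdeleRing.ideleBaseChange (↥(maximalRealSubfield L)) L x) = quadraticHeckeCharCM L x)
    (ξ : OneDimAutRepH L) (σ : L →+* ℂ) (hσ : InfinitePlace.mk σ = w.1) :
    (ξ.eη w.1, ξ.eψ w.1) ∈ onesCompatRow L ι μω w ↔ ξ.IsCohTrivialAt (ArchSignRecipe.tOfArchType (archTypeOfRecord μω) σ) σ :=
  eExponents_mem_rowOfArchType_iff L ι (archTypeOfRecord μω) w (odd_archTypeOfRecord μω hμu hμω w.1) ξ σ hσ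

/-- **EVERY COMPACT COMPONENT OF A PINNED GLOBAL `ξ` IS LICENSED**: if `ξ` carries F0P2's archimedean pin ★ `XiArchPinned L ξ μω k` (odd `k`, `ξ_σ` cohomological at
every `σ`), then `(ξ.eη w, ξ.eψ w) ∈ rowOfArchType k w` at every compact place. [cite: Rogawski1990, Prop. 15.2.1 p. 249; §14.4 Prop. 14.4.2 p. 236] -/
theorem eExponents_mem_rowOfArchType_of_xiArchPinned {ξ : OneDimAutRepH L} {μω : HeckeCharacter L} {k : InfinitePlace L → ℤ}
    (hpin : XiArchPinned L ξ μω k) (w : CptPlace L ι) : (ξ.eη w.1, ξ.eψ w.1) ∈ rowOfArchType L ι k w :=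
  (eExponents_mem_rowOfArchType_iff L ι k w (hpin.2.1 w.1) ξ w.1.embedding (InfinitePlace.mk_embedding w.1)).2 (hpin.2.2 _)

/-- **… hence lies in the rows OF RECORD** (unitary `μω`: the pinned type `k` IS `k₀`, ★ `archTypeOfRecord_eq`). [cite: Rogawski1990, Prop. 15.2.1 p. 249; §14.4 Prop. 14.4.2 p. 236]
[cite: Liu2021, Remark 4.2] -/
theorem eExponents_mem_onesCompatRow_of_xiArchPinned {ξ : OneDimAutRepH L} {μω : HeckeCharacter L} (hμu : μω.IsUnitary) {k : InfinitePlace L → ℤ}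
    (hpin : XiArchPinned L ξ μω k) (w : CptPlace L ι) : (ξ.eη w.1, ξ.eψ w.1) ∈ onesCompatRow L ι μω w := by
  rw [onesCompatRow_eq_rowOfArchType L ι hμu hpin.1]
  exact eExponents_mem_rowOfArchType_of_xiArchPinned L ι hpin w

/-- **The `t_w`-spelling of RULING S2-R15 (3)**: with `t_w := tOfArchType k σ_w` Rogawski's parameter at Mathlib's embedding `σ_w` of `w` (`expAt k σ_w = −k w`, so
`t_w = (k w − 1)∕2` for odd `k w`), the rows are `{(t_w + 2, −1), (t_w − 1, 1)}` («`(κ.1 + t_w, κ.2)` on the locus»). [cite: Rogawski1990, §12.3 pp. 174–178] -/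
theorem rowOfArchType_eq_pair_tOfArchType (hk : Odd (k w.1)) :
    rowOfArchType L ι k w =
      {(ArchSignRecipe.tOfArchType k w.1.embedding + 2, -1), (ArchSignRecipe.tOfArchType k w.1.embedding - 1, 1)} := by
  obtain ⟨m, hm⟩ := hk
  have ht : ArchSignRecipe.tOfArchType k w.1.embedding = m := by
    unfold ArchSignRecipe.tOfArchType
    rw [OneDimAutRepH.expAt_embedding, hm]
    omega
  have h1 : (k w.1 + 3) / 2 = m + 2 := by omega
  have h2 : (k w.1 - 3) / 2 = m - 1 := by omega
  rw [rowOfArchType, ht, h1, h2]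

/-- The rows of record in the `t_w`-spelling, `t_w = tShift`-analogue at `w`: `{(t_w + 2, −1), (t_w − 1, 1)}`, `t_w = tOfArchType (archTypeOfRecord μω) σ_w`.
[cite: Rogawski1990, §12.3 pp. 174–178] [cite: Liu2021, Remark 4.2] -/
theorem onesCompatRow_eq_pair_tOfArchType (hμu : μω.IsUnitary)
    (hμω : ∀ x : GaloisRepresentations.ideleGroup ↥(maximalRealSubfield L),
      μω (AdeleRing.ideleBaseChange (↥(maximalRealSubfield L)) L x) = quadraticHeckeCharCM L x) :
    onesCompatRow L ι μω w =
      {(ArchSignRecipe.tOfArchType (archTypeOfRecord μω) w.1.embedding + 2, -1),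
        (ArchSignRecipe.tOfArchType (archTypeOfRecord μω) w.1.embedding - 1, 1)} :=
  rowOfArchType_eq_pair_tOfArchType L ι (archTypeOfRecord μω) w (odd_archTypeOfRecord μω hμu hμω w.1)

/-! ## §3 The rows-of-record predicate on an extension datum [§14.4 Prop. 14.4.2 (c) p. 236] -/

/-- **`X.IsRowsOfRecord L ι μω`** (spec (iii), RULING S2-R15 (3)): the extension datum `X` licenses at every compact place EXACTLY the two `𝟙`-compatible rows of
record, each with sign `−1` relative to `Δ″_w` (Prop. 14.4.2 (c): `Tr ξ_w(f′^H) = −Tr 𝟙(f′)`, `mn ≠ 0`).  σ14 (KT3) is typed once over `X` under this hypothesis.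
[cite: Rogawski1990, §14.4 Prop. 14.4.2 p. 236] -/
def HInfExt.IsRowsOfRecord (μω : HeckeCharacter L) (X : HInfExt L ι) : Prop :=
  ∀ w : CptPlace L ι, X.cptLab w = onesCompatRow L ι μω w ∧ ∀ κ ∈ X.cptLab w, X.cptSign w κ = -1

variable (X : HInfExt L ι)

/-- Unfolding (`Iff.rfl`). [cite: Rogawski1990, §14.4 Prop. 14.4.2 p. 236] -/
theorem HInfExt.isRowsOfRecord_iff :
    X.IsRowsOfRecord L ι μω ↔ ∀ w : CptPlace L ι, X.cptLab w = onesCompatRow L ι μω w ∧ ∀ κ ∈ X.cptLab w, X.cptSign w κ = -1 :=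
  Iff.rfl

variable {L ι μω X}

/-- Read-back: the licensed rows of a datum of record. [cite: Rogawski1990, §14.4 Prop. 14.4.2 p. 236] -/
theorem HInfExt.IsRowsOfRecord.cptLab_eq (h : X.IsRowsOfRecord L ι μω) (w : CptPlace L ι) : X.cptLab w = onesCompatRow L ι μω w :=
  (h w).1

/-- Read-back: the signs of a datum of record are `−1` on its rows. [cite: Rogawski1990, §14.4 Prop. 14.4.2 p. 236] -/
theorem HInfExt.IsRowsOfRecord.cptSign_eq (h : X.IsRowsOfRecord L ι μω) (w : CptPlace L ι) {κ : ℤ × ℤ} (hκ : κ ∈ X.cptLab w) :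
    X.cptSign w κ = -1 :=
  (h w).2 κ hκ

/-- Membership in the rows of a datum of record is membership in `onesCompatRow`. [cite: Rogawski1990, §14.4 Prop. 14.4.2 p. 236] -/
theorem HInfExt.IsRowsOfRecord.mem_cptLab_iff (h : X.IsRowsOfRecord L ι μω) (w : CptPlace L ι) (κ : ℤ × ℤ) :
    κ ∈ X.cptLab w ↔ κ ∈ onesCompatRow L ι μω w := by
  rw [h.cptLab_eq w]

/-- A datum of record licenses exactly two rows at each compact place. [cite: Rogawski1990, §14.4 Prop. 14.4.2 p. 236] -/
theorem HInfExt.IsRowsOfRecord.card_cptLab (h : X.IsRowsOfRecord L ι μω) (w : CptPlace L ι) : (X.cptLab w).card = 2 := by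
  rw [h.cptLab_eq w, card_onesCompatRow]

/-- A datum of record HAS a licensed compact exponent vector (one row chosen per place). [cite: Rogawski1990, §14.4 Prop. 14.4.2 p. 236] -/
theorem HInfExt.IsRowsOfRecord.nonempty_licensed (h : X.IsRowsOfRecord L ι μω) :
    Nonempty {κ : CptPlace L ι → ℤ × ℤ // ∀ w, κ w ∈ X.cptLab w} :=
  ⟨⟨fun w => ((archTypeOfRecord μω w.1 + 3) / 2, -1), fun w => by
    rw [h.cptLab_eq w]; exact fst_mem_rowOfArchType L ι (archTypeOfRecord μω) w⟩⟩

/-- A datum of record has `H_∞`-packets: the character packet `ξ_ι(0,0) ⊗ (a row of record at each w)`. [cite: Rogawski1990, §13.3 Thm. 13.3.7 p. 203; §14.4 Prop. 14.4.2 p. 236] -/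
theorem HInfExt.IsRowsOfRecord.nonempty_pktInfH (h : X.IsRowsOfRecord L ι μω) : Nonempty (PktInfH L ι X) :=
  ⟨(HLabIota.xi 0 0, Classical.choice h.nonempty_licensed)⟩

/-- For a PINNED global `ξ` and a datum of record, `ξ`'s compact exponent vector is licensed. [cite: Rogawski1990, Prop. 15.2.1 p. 249; §14.4 Prop. 14.4.2 p. 236]
[cite: Liu2021, Remark 4.2] -/
theorem HInfExt.IsRowsOfRecord.eExponents_mem_cptLab (h : X.IsRowsOfRecord L ι μω) (hμu : μω.IsUnitary) {ξ : OneDimAutRepH L}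
    {k : InfinitePlace L → ℤ} (hpin : XiArchPinned L ξ μω k) (w : CptPlace L ι) : (ξ.eη w.1, ξ.eψ w.1) ∈ X.cptLab w := by
  rw [h.cptLab_eq w]
  exact eExponents_mem_onesCompatRow_of_xiArchPinned L ι hμu hpin w

variable (L ι μω)

/-- **The `d = 1` print shell ★ `xiOnly` is NOT of record as soon as there is a compact place** (it licenses `∅ ≠` two rows; ★ `nonempty_cptPlace_of_two_le_finrank`
gives the place at the letters' frames). [cite: Rogawski1990, §14.4 p. 236; §14.6 p. 244] -/
theorem HInfExt.not_isRowsOfRecord_xiOnly [h : Nonempty (CptPlace L ι)] : ¬ (HInfExt.xiOnly L ι).IsRowsOfRecord L ι μω := by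
  intro hX
  have hc := hX.card_cptLab h.some
  rw [HInfExt.xiOnly_cptLab, Finset.card_empty] at hc
  omega

/-! ## §4 The instance of record `HInfExt.xiRows L ι μω` [§14.4 Prop. 14.4.2 (c) p. 236; §13.3 Thm. 13.3.7 p. 203] -/

/-- **`HInfExt.xiRows L ι μω` — THE EXTENSION DATUM OF RECORD ON PATH** (spec (iv), RULING S2-R15 (3)): no extension labels∕tokens (the square-integrable `H_∞`-labels are
hole G-H2), and at every compact place the two `𝟙_{U(3)_w}`-compatible character rows of record, sign `−1` each (junk `0` off the rows) — ★ `HInfExt.ofCptRows`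
(brick 2) at `R := onesCompatRow L ι μω`. [cite: Rogawski1990, §14.4 Prop. 14.4.2 p. 236; §12.3 p. 178] -/
def HInfExt.xiRows (μω : HeckeCharacter L) : HInfExt L ι :=
  HInfExt.ofCptRows L ι (onesCompatRow L ι μω) (fun w κ => if κ ∈ onesCompatRow L ι μω w then -1 else 0)

/-- Read-back (`rfl`): the rows of `xiRows`. [cite: Rogawski1990, §14.4 Prop. 14.4.2 p. 236] -/
@[simp] theorem HInfExt.xiRows_cptLab : (HInfExt.xiRows L ι μω).cptLab w = onesCompatRow L ι μω w := rfl

/-- Read-back: the sign definition of `xiRows`. [cite: Rogawski1990, §14.4 Prop. 14.4.2 p. 236] -/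
theorem HInfExt.xiRows_cptSign (κ : ℤ × ℤ) :
    (HInfExt.xiRows L ι μω).cptSign w κ = if κ ∈ onesCompatRow L ι μω w then -1 else 0 := rfl

/-- **Sign `−1` on the rows** (Prop. 14.4.2 (c), `mn ≠ 0`). [cite: Rogawski1990, §14.4 Prop. 14.4.2 p. 236] -/
theorem HInfExt.xiRows_cptSign_of_mem {κ : ℤ × ℤ} (hκ : κ ∈ onesCompatRow L ι μω w) : (HInfExt.xiRows L ι μω).cptSign w κ = -1 := by
  rw [HInfExt.xiRows_cptSign, if_pos hκ]

/-- Junk `0` off the rows. [cite: Rogawski1990, §14.4 Prop. 14.4.2 p. 236] -/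
theorem HInfExt.xiRows_cptSign_of_not_mem {κ : ℤ × ℤ} (hκ : κ ∉ onesCompatRow L ι μω w) : (HInfExt.xiRows L ι μω).cptSign w κ = 0 := by
  rw [HInfExt.xiRows_cptSign, if_neg hκ]

/-- `xiRows` unfolds to ★ `ofCptRows` (`rfl`; for consumers of brick 2's API). [cite: Rogawski1990, §14.4 Prop. 14.4.2 p. 236] -/
theorem HInfExt.xiRows_eq_ofCptRows :
    HInfExt.xiRows L ι μω = HInfExt.ofCptRows L ι (onesCompatRow L ι μω) (fun w κ => if κ ∈ onesCompatRow L ι μω w then -1 else 0) := rfl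

/-- **`xiRows` IS of record.** [cite: Rogawski1990, §14.4 Prop. 14.4.2 p. 236] -/
theorem HInfExt.xiRows_isRowsOfRecord : (HInfExt.xiRows L ι μω).IsRowsOfRecord L ι μω :=
  fun w => ⟨rfl, fun _ hκ => HInfExt.xiRows_cptSign_of_mem L ι μω w hκ⟩

/-- `xiRows` licenses a compact exponent vector. [cite: Rogawski1990, §14.4 Prop. 14.4.2 p. 236] -/
theorem nonempty_licensed_xiRows : Nonempty {κ : CptPlace L ι → ℤ × ℤ // ∀ w, κ w ∈ (HInfExt.xiRows L ι μω).cptLab w} :=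
  nonempty_licensed_ofCptRows L ι _ _ (onesCompatRow_nonempty L ι μω)

/-- **ON PATH THE KIT OF RECORD HAS `H_∞`-PACKETS** — the positive twin of ★ S2-R15 FACT `isEmpty_pktInfH_xiOnly`: `PktInfH (xiRows L ι μω)` is non-empty (the character
packets `ξ_ι(p, q) ⊗ (a row of record at each compact place)` — exactly the packets through which global one-dimensional `ξ` enter, Thm. 13.3.7 ∕ 14.6.4).
[cite: Rogawski1990, §13.3 Thm. 13.3.7 p. 203; §14.4 Prop. 14.4.2 p. 236] -/
theorem nonempty_pktInfH_xiRows : Nonempty (PktInfH L ι (HInfExt.xiRows L ι μω)) :=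
  nonempty_pktInfH_ofCptRows L ι _ _ (onesCompatRow_nonempty L ι μω)

/-- Kit-level form (★ `rogawskiArchKitH_PktInfH`, `rfl`). [cite: Rogawski1990, §13.3 Thm. 13.3.7 p. 203; §12.3 p. 178] -/
theorem nonempty_pktInfH_rogawskiArchKitH_xiRows (H : Matrix (Fin 3) (Fin 3) L) :
    Nonempty (rogawskiArchKitH L ι H μω (HInfExt.xiRows L ι μω)).PktInfH :=
  nonempty_pktInfH_xiRows L ι μω

/-- **S7's `ρXi ξ` IS CONSTRUCTIBLE in the kit of record**: for a PINNED global `ξ` (★ `XiArchPinned L ξ μω k`, unitary `μω`) the compact exponent vector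
`fun w => (ξ.eη w, ξ.eψ w)` is licensed by `xiRows`, so `(xi (ξ.pη ι) (ξ.qψ ι), ⟨_, this⟩) : PktInfH (xiRows L ι μω)` is its character packet (the vector of ★ pin
`archTrHOfRecord_xiTok_ofRecord`). [cite: Rogawski1990, Prop. 15.2.1 p. 249; §13.3 Thm. 13.3.7 p. 203; §14.4 Prop. 14.4.2 p. 236] [cite: Liu2021, Remark 4.2] -/
theorem exponents_licensed_xiRows_of_xiArchPinned {μω : HeckeCharacter L} (hμu : μω.IsUnitary) {ξ : OneDimAutRepH L} {k : InfinitePlace L → ℤ}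
    (hpin : XiArchPinned L ξ μω k) : ∀ w : CptPlace L ι, (ξ.eη w.1, ξ.eψ w.1) ∈ (HInfExt.xiRows L ι μω).cptLab w :=
  fun w => eExponents_mem_onesCompatRow_of_xiArchPinned L ι hμu hpin w

/-- **The character packet of a pinned global `ξ` in the kit of record** (its `ι`-label `xi (pη ξ ι) (qψ ξ ι)` with the licensed compact vector of `ξ`).
[cite: Rogawski1990, §13.3 Thm. 13.3.7 p. 203; Prop. 15.2.1 p. 249] [cite: Liu2021, Remark 4.2] -/
def pktInfHOfPinned {μω : HeckeCharacter L} (hμu : μω.IsUnitary) (ξ : OneDimAutRepH L) {k : InfinitePlace L → ℤ}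
    (hpin : XiArchPinned L ξ μω k) : PktInfH L ι (HInfExt.xiRows L ι μω) :=
  (HLabIota.xi (ξ.pη ι) (ξ.qψ ι), ⟨fun w => (ξ.eη w.1, ξ.eψ w.1), exponents_licensed_xiRows_of_xiArchPinned L ι hμu hpin⟩)

/-- Read-back (`rfl`): the `ι`-label of the packet of a pinned `ξ`. [cite: Rogawski1990, §12.3 p. 178] -/
theorem pktInfHOfPinned_fst {μω : HeckeCharacter L} (hμu : μω.IsUnitary) (ξ : OneDimAutRepH L) {k : InfinitePlace L → ℤ}
    (hpin : XiArchPinned L ξ μω k) : (pktInfHOfPinned L ι hμu ξ hpin).1 = HLabIota.xi (ξ.pη ι) (ξ.qψ ι) := rfl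

/-- Read-back (`rfl`): the compact exponent vector of the packet of a pinned `ξ` is `fun w => (ξ.eη w, ξ.eψ w)`. [cite: Rogawski1990, §14.4 Prop. 14.4.2 p. 236] -/
theorem pktInfHOfPinned_snd_val {μω : HeckeCharacter L} (hμu : μω.IsUnitary) (ξ : OneDimAutRepH L) {k : InfinitePlace L → ℤ}
    (hpin : XiArchPinned L ξ μω k) : (pktInfHOfPinned L ι hμu ξ hpin).2.1 = fun w => (ξ.eη w.1, ξ.eψ w.1) := rfl

/-- **The lift of the packet of a pinned `ξ` is `ξ`'s A-pair label of record** (★ `xiHInf_xi`: `aPair (pη ξ ι + tShift) (qψ ξ ι)`). [cite: Rogawski1990, §12.3 Prop. 12.3.3 p. 178] -/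
theorem xiHInf_pktInfHOfPinned {μω : HeckeCharacter L} (hμu : μω.IsUnitary) (ξ : OneDimAutRepH L) {k : InfinitePlace L → ℤ}
    (hpin : XiArchPinned L ξ μω k) :
    xiHInf L ι μω (HInfExt.xiRows L ι μω) (pktInfHOfPinned L ι hμu ξ hpin) = ArchPktLabel.aPair (ξ.pη ι + tShift L ι μω) (ξ.qψ ι) := rfl

section Laws

variable (νHi : @MeasureTheory.Measure (UnitaryGroup.arch (↥(maximalRealSubfield L)) L (IsCMField.complexConj L) 2 (F0P3InnerFormClassificationV6.splitForm L 2) ×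
  UnitaryGroup.arch (↥(maximalRealSubfield L)) L (IsCMField.complexConj L) 1 (F0P3InnerFormClassificationV6.splitForm L 1)) (borel _))

/-- The EXTENSION law-share (KH5) of `xiRows` holds vacuously (no extension token; ★ `ofCptRows_lawKH5`) — NOT the (KH5) content on `xi`-labels (★ `archTrHOfRecord_xiTok_const_smul`).
[cite: Rogawski1990, §13.3 p. 203] -/
theorem HInfExt.xiRows_lawKH5 : (HInfExt.xiRows L ι μω).LawKH5 L ι νHi :=
  HInfExt.ofCptRows_lawKH5 L ι _ _ νHi

/-- The EXTENSION law-share (KT3) of `xiRows` holds vacuously (no extension label; ★ `ofCptRows_lawKT3`) — NOT the (KT3) content on `xi`-labels, which is the export's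
σ14 debt over `X` with `X.IsRowsOfRecord`.  Binders spelled verbatim as ★ `HInfExt.LawKT3`. [cite: Rogawski1990, §12.3 Prop. 12.3.3 p. 178; §14.4 Prop. 14.4.2 p. 236] -/
theorem HInfExt.xiRows_lawKT3 (H : Matrix (Fin 3) (Fin 3) L) (Tinf : ArchTransferFactor L H)
    (mHi : letI : ∀ a : UnitaryGroup.arch (↥(maximalRealSubfield L)) L (IsCMField.complexConj L) 2 (F0P3InnerFormClassificationV6.splitForm L 2) × UnitaryGroup.arch (↥(maximalRealSubfield L)) L (IsCMField.complexConj L) 1 (F0P3InnerFormClassificationV6.splitForm L 1), MeasurableSpace ((UnitaryGroup.arch (↥(maximalRealSubfield L)) L (IsCMField.complexConj L) 2 (F0P3InnerFormClassificationV6.splitForm L 2) × UnitaryGroup.arch (↥(maximalRealSubfield L)) L (IsCMField.complexConj L) 1 (F0P3InnerFormClassificationV6.splitForm L 1)) ⧸ Subgroup.centralizer ({a} : Set (UnitaryGroup.arch (↥(maximalRealSubfield L)) L (IsCMField.complexConj L) 2 (F0P3InnerFormClassificationV6.splitForm L 2) × UnitaryGroup.arch (↥(maximalRealSubfield L)) L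 (IsCMField.complexConj L) 1 (F0P3InnerFormClassificationV6.splitForm L 1)))) := fun _ => borel _;
      OrbitalMeasureFamily (UnitaryGroup.arch (↥(maximalRealSubfield L)) L (IsCMField.complexConj L) 2 (F0P3InnerFormClassificationV6.splitForm L 2) × UnitaryGroup.arch (↥(maximalRealSubfield L)) L (IsCMField.complexConj L) 1 (F0P3InnerFormClassificationV6.splitForm L 1)))
    (mGi : letI : ∀ γ : UnitaryGroup.arch (↥(maximalRealSubfield L)) L (IsCMField.complexConj L) 3 H, MeasurableSpace (UnitaryGroup.arch (↥(maximalRealSubfield L)) L (IsCMField.complexConj L) 3 H ⧸ Subgroup.centralizer ({γ} : Set (UnitaryGroup.arch (↥(maximalRealSubfield L)) L (IsCMField.complexConj L) 3 H))) := fun _ => borel _;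
      OrbitalMeasureFamily (UnitaryGroup.arch (↥(maximalRealSubfield L)) L (IsCMField.complexConj L) 3 H))
    (archTr' : F0P3InnerFormClassificationV6.Cinf → (UnitaryGroup.arch (↥(maximalRealSubfield L)) L (IsCMField.complexConj L) 3 H → ℂ) → ℂ) :
    (HInfExt.xiRows L ι μω).LawKT3 L ι H μω Tinf mHi mGi νHi archTr' :=
  HInfExt.ofCptRows_lawKT3 L ι _ _ νHi H μω Tinf mHi mGi archTr'

end Laws

end Frame

end Summit.HodgeConjecture.HodgeConjecture.R90.S2

end
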